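import Summits.Ventures.HodgeRepro.Night3WeilModelFaces
import Summits.Ventures.HodgeRepro.Night3GSetKunneth

/-!
# The `G`-set instance of the Weil model: `hW` and `hℓ` as theorems, and «S4 on the CONCRETE Weil spaces of the census
faces ⟹ S4 on the concrete Weil space of every zero-sum corner product»

Blind re-derivation cell `pub-hodge-repro`, seat `night-3` (gen 4).  Imports night-3's `Night3WeilModelFaces` (gen 2's
abstract `WeilModel` with Lemma P's product closure and cancellation as theorems, composed with gen 0's
«S4-faces ⟹ S4» on typer's `(G, c)` model: `WeilModel.alg_of_faces_gset`) and `Night3GSetKunneth` (the lex-ordered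
wedge basis, the `σ`-lines `line n σ`, the Künneth component projection `kun n k` with `kun_line`).
Namespace `HodgeRepro.Night3.GSetModel`.

Gen 2's `WeilModel` is ABSTRACT: `H a` any `K`-space, `κ` any linear map, `ℓ` any vectors, the five fields hypotheses.
Here the model is built CONCRETELY on the cell's dictionary side (typer-2 `CMHodgeOn`, night-1's Weil lines), with
`K = L = ℂ`: for a multiset `M` of CM types (subsets of the Galois group `G`) with `|M|` factors,

* `H M := ⋀^{|M|} ℂ^{Fin |M| × G}` — `H^{|M|}(B_M, ℂ)` in eigen-coordinates (`(i, σ) ↦` the `σ`-eigenline of the `i`-th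
  factor; Deligne LNM 900 Ex. 3.7);
* `κ M N := kun |M| |N| ∘ cast (|M + N| = |M| + |N|)` — the Künneth component projection (`Night3GSetKunneth`);
* `ℓ M σ := 1 ⊗ line |M| σ` — the `σ`-line wedge `e_{(0,σ)} ∧ ⋯ ∧ e_{(|M|−1,σ)}`;
* `weilSpace M := span {line |M| σ : σ ∈ G}` — the concrete Weil space `W_F(B_M) ⊗ ℂ` (night-1's `weilSpaceProd`
  with the identity enumeration);

and the two fields that speak only about `H`, `κ`, `ℓ`, `W` become THEOREMS: `hW` (`Submodule.baseChange_span`) and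
`hℓ` (`kun_line`, the lines are carried to lines by the cast).  The remaining three fields — `Alg` (the algebraic
classes), `Q` (the form `∫ x ∪ y ∪ Λ`) with `hmul` / `hproj` / `hQ` — are the algebraic-cycle identifications of
LEMMA-L-P-v2.md and stay HYPOTHESES, now about the concrete `κ` and lines (`gsetModel`).  The composition
(`weilSpace_le_alg_of_faces`): **in the concrete model, if the Weil spaces of the pairs `{Φ, c • Φ}` (Lefschetz (1,1))
and of the census faces `faceCornersMul c Φ p p'` (the route's open input) are algebraic, then the concrete Weil space
`weilSpace M` is algebraic for every zero-sum multiset `M` of CM types** — with Lemma L (typer-2), the combinatorics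
(gen 0), Lemma P's linear algebra (gen 2) AND the Künneth / eigenline bookkeeping of the dictionary (this row) in the
kernel.  What is NOT modelled: `Alg` and `Q` (S4 IS the statement `weilSpace M ≤ Alg M`), the cup product, the cycle
map, the `ℚ`-structure (`K = L = ℂ`; the `ℚ`-form is night-1's `ratWeil`).  Nothing here closes S4: `hface` stays a
hypothesis; no sealed file is touched; no Tier-2 item depends on this file.
-/

set_option autoImplicit false

open Finset Module TensorProduct
open scoped Pointwise

namespace HodgeRepro.Night3.GSetModel

open HodgeRepro.CMHodgeOn

section Model

variable {G : Type*} [Fintype G] [DecidableEq G] [LinearOrder G]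

/-- `H^{|M|}(B_M, ℂ)` in eigen-coordinates: `⋀^{|M|} ℂ^{Fin |M| × G}`. -/
abbrev H (M : Multiset (Finset G)) : Type _ := Hn G (Multiset.card M)

omit [Fintype G] [DecidableEq G] [LinearOrder G] in
/-- Transport of `Hn G d` along an equality of the number of factors. -/
def castH {d d' : ℕ} (h : d = d') : Hn G d ≃ₗ[ℂ] Hn G d' := by
  subst h
  exact LinearEquiv.refl ℂ (Hn G d)

omit [Fintype G] [LinearOrder G] in
/-- The cast carries lines to lines. -/
theorem castH_line {d d' : ℕ} (h : d = d') (σ : G) : castH h (line d σ) = line d' σ := by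
  subst h
  rfl

/-- **The Künneth map of the model**: `H (M + N) → H M ⊗ H N`, the Künneth component projection `kun` after the
identification `|M + N| = |M| + |N|`. -/
noncomputable def κ (M N : Multiset (Finset G)) : H (M + N) →ₗ[ℂ] H M ⊗[ℂ] H N :=
  kun (Multiset.card M) (Multiset.card N) ∘ₗ (castH (Multiset.card_add M N)).toLinearMap

/-- `κ` carries the `σ`-line of `M + N` to the tensor of the `σ`-lines of `M` and `N`. -/
theorem κ_line (M N : Multiset (Finset G)) (σ : G) :
    κ M N (line (Multiset.card (M + N)) σ) = line (Multiset.card M) σ ⊗ₜ[ℂ] line (Multiset.card N) σ := by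
  rw [κ, LinearMap.comp_apply, LinearEquiv.coe_coe, castH_line, kun_line]

omit [Fintype G] [LinearOrder G] in
/-- **The `σ`-line of the model**, in `ℂ ⊗[ℂ] H M`: `1 ⊗ line |M| σ`. -/
noncomputable def ℓ (M : Multiset (Finset G)) (σ : G) : ℂ ⊗[ℂ] H M := (1 : ℂ) ⊗ₜ[ℂ] line (Multiset.card M) σ

omit [Fintype G] [LinearOrder G] in
/-- **The concrete Weil space** `W_F(B_M) ⊗ ℂ = span {ℓ_σ(M) : σ ∈ G}` (night-1's `weilSpaceProd`, identity
enumeration). -/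
noncomputable def weilSpace (M : Multiset (Finset G)) : Submodule ℂ (H M) :=
  Submodule.span ℂ (Set.range (line (Multiset.card M)))

omit [Fintype G] [LinearOrder G] in
/-- Every line lies in the Weil space. -/
theorem line_mem_weilSpace (M : Multiset (Finset G)) (σ : G) : line (Multiset.card M) σ ∈ weilSpace M :=
  Submodule.subset_span ⟨σ, rfl⟩

omit [Fintype G] [LinearOrder G] in
/-- **The field `hW`, as a theorem**: `(weilSpace M) ⊗ ℂ = span {ℓ M σ}`. -/
theorem hW (M : Multiset (Finset G)) : (weilSpace M).baseChange ℂ = Submodule.span ℂ (Set.range (ℓ M)) := by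
  rw [weilSpace, Submodule.baseChange_span, ← Set.range_comp]
  rfl

/-- **The field `hℓ`, as a theorem**: `κ ⊗ ℂ (ℓ (M + N) σ) = ℓ M σ ⊗ ℓ N σ` under `distribBaseChange`. -/
theorem hℓ (M N : Multiset (Finset G)) (σ : G) :
    (κ M N).baseChange ℂ (ℓ (M + N) σ) =
      (AlgebraTensorModule.distribBaseChange ℂ ℂ (H M) (H N)).symm (ℓ M σ ⊗ₜ[ℂ] ℓ N σ) := by
  simp only [ℓ]
  rw [LinearMap.baseChange_tmul, AlgebraTensorModule.distribBaseChange_symm_tmul, one_mul, κ_line]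

/-- **The `G`-set instance of the Weil model.**  `H`, `κ`, `ℓ`, `W` are the concrete objects above (`hW`, `hℓ`
theorems); `Alg`, `Q` with `hmul` (products of pull-backs of algebraic classes are algebraic), `hproj` (the
correspondence `pr_*((·) ∪ pr^*(y ∪ Λ))`, `y` algebraic, maps algebraic classes to algebraic classes) and `hQ` (for
`N ≠ 0` every line pairs non-trivially with some line under `Q_N`) are the hypotheses — the algebraic-cycle
identifications of LEMMA-L-P-v2.md, now stated on the concrete Künneth map and lines. -/
noncomputable def gsetModel (Alg : ∀ M : Multiset (Finset G), Submodule ℂ (H M))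
    (Q : ∀ M : Multiset (Finset G), LinearMap.BilinForm ℂ (H M))
    (hmul : ∀ M N, (Submodule.map₂ (TensorProduct.mk ℂ (H M) (H N)) (Alg M) (Alg N)).comap (κ M N) ≤ Alg (M + N))
    (hproj : ∀ M N (y : H N), y ∈ Alg N →
      ((Alg (M + N)).map (κ M N)).map (LemmaP.contract ((Q N).flip y)) ≤ Alg M)
    (hQ : ∀ N, N ≠ 0 → ∀ σ, ∃ τ, Q N (line (Multiset.card N) σ) (line (Multiset.card N) τ) ≠ 0) :
    WeilModel ℂ ℂ G (Multiset (Finset G)) where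
  H := H
  κ := κ
  ℓ := ℓ
  W := weilSpace
  Alg := Alg
  Q := Q
  hW := hW
  hℓ := hℓ
  hmul := hmul
  hproj := hproj
  hQ := fun N hN σ => by
    obtain ⟨τ, h⟩ := hQ N hN σ
    refine ⟨τ, ?_⟩
    simp only [ℓ]
    rw [LinearMap.BilinForm.baseChange_tmul, one_mul, smul_eq_mul, mul_one]
    exact h

/-- The Weil space of the instance is the concrete Weil space. -/
@[simp] theorem gsetModel_W (Alg : ∀ M : Multiset (Finset G), Submodule ℂ (H M))
    (Q : ∀ M : Multiset (Finset G), LinearMap.BilinForm ℂ (H M)) (hmul) (hproj) (hQ) (M : Multiset (Finset G)) :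
    (gsetModel Alg Q hmul hproj hQ).W M = weilSpace M := rfl

/-- The algebraic classes of the instance are the given `Alg`. -/
@[simp] theorem gsetModel_Alg (Alg : ∀ M : Multiset (Finset G), Submodule ℂ (H M))
    (Q : ∀ M : Multiset (Finset G), LinearMap.BilinForm ℂ (H M)) (hmul) (hproj) (hQ) (M : Multiset (Finset G)) :
    (gsetModel Alg Q hmul hproj hQ).Alg M = Alg M := rfl

/-- **Lemma P, step (1), on the concrete model**: if the concrete Weil spaces of `M` and `N` are algebraic, so is that of
`M + N` (gen 2's `WeilModel.alg_add` on `gsetModel`). -/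
theorem weilSpace_add_le_alg (Alg : ∀ M : Multiset (Finset G), Submodule ℂ (H M))
    (Q : ∀ M : Multiset (Finset G), LinearMap.BilinForm ℂ (H M))
    (hmul : ∀ M N, (Submodule.map₂ (TensorProduct.mk ℂ (H M) (H N)) (Alg M) (Alg N)).comap (κ M N) ≤ Alg (M + N))
    (hproj : ∀ M N (y : H N), y ∈ Alg N →
      ((Alg (M + N)).map (κ M N)).map (LemmaP.contract ((Q N).flip y)) ≤ Alg M)
    (hQ : ∀ N, N ≠ 0 → ∀ σ, ∃ τ, Q N (line (Multiset.card N) σ) (line (Multiset.card N) τ) ≠ 0)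
    (M N : Multiset (Finset G)) (hM : weilSpace M ≤ Alg M) (hN : weilSpace N ≤ Alg N) :
    weilSpace (M + N) ≤ Alg (M + N) :=
  (gsetModel Alg Q hmul hproj hQ).alg_add M N hM hN

/-- **Lemma P, steps (2)–(3), on the concrete model**: if the concrete Weil spaces of `M + N` and `N` are algebraic, so
is that of `M` (gen 2's `WeilModel.alg_cancel` on `gsetModel`). -/
theorem weilSpace_le_alg_of_add (Alg : ∀ M : Multiset (Finset G), Submodule ℂ (H M))
    (Q : ∀ M : Multiset (Finset G), LinearMap.BilinForm ℂ (H M))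
    (hmul : ∀ M N, (Submodule.map₂ (TensorProduct.mk ℂ (H M) (H N)) (Alg M) (Alg N)).comap (κ M N) ≤ Alg (M + N))
    (hproj : ∀ M N (y : H N), y ∈ Alg N →
      ((Alg (M + N)).map (κ M N)).map (LemmaP.contract ((Q N).flip y)) ≤ Alg M)
    (hQ : ∀ N, N ≠ 0 → ∀ σ, ∃ τ, Q N (line (Multiset.card N) σ) (line (Multiset.card N) τ) ≠ 0)
    (M N : Multiset (Finset G)) (hMN : weilSpace (M + N) ≤ Alg (M + N)) (hN : weilSpace N ≤ Alg N) :
    weilSpace M ≤ Alg M :=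
  (gsetModel Alg Q hmul hproj hQ).alg_cancel M N hMN hN

end Model

section Composition

variable {G : Type*} [Group G] [Fintype G] [DecidableEq G] [LinearOrder G]

/-- **«S4-faces ⟹ S4» on the concrete `G`-set model.**  `G` a finite group with a complex conjugation `c` (typer's
`IsComplexConj`); `Alg`, `Q` with `hmul` / `hproj` / `hQ` the algebraic-cycle hypotheses on the concrete Künneth map and
lines.  If the concrete Weil spaces `weilSpace {Φ, c • Φ}` of the conjugate pairs are algebraic (Lefschetz (1,1)) and the
concrete Weil spaces `weilSpace (faceCornersMul c Φ p p')` of the census faces are algebraic (S4 on the faces — the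
route's open input), then the concrete Weil space `weilSpace M` is algebraic for every zero-sum multiset `M` of CM
types (`IsZeroSumG c M`): S4 for the field.  Lemma L (typer-2), the closure combinatorics (gen 0), Lemma P's linear
algebra (gen 2) and the Künneth / eigenline bookkeeping (this row) are all in the kernel. -/
theorem weilSpace_le_alg_of_faces {c : G} (hc : IsComplexConj c)
    (Alg : ∀ M : Multiset (Finset G), Submodule ℂ (H M))
    (Q : ∀ M : Multiset (Finset G), LinearMap.BilinForm ℂ (H M))
    (hmul : ∀ M N, (Submodule.map₂ (TensorProduct.mk ℂ (H M) (H N)) (Alg M) (Alg N)).comap (κ M N) ≤ Alg (M + N))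
    (hproj : ∀ M N (y : H N), y ∈ Alg N →
      ((Alg (M + N)).map (κ M N)).map (LemmaP.contract ((Q N).flip y)) ≤ Alg M)
    (hQ : ∀ N, N ≠ 0 → ∀ σ, ∃ τ, Q N (line (Multiset.card N) σ) (line (Multiset.card N) τ) ≠ 0)
    (hpair : ∀ Φ, IsCMType c Φ → weilSpace {Φ, c • Φ} ≤ Alg {Φ, c • Φ})
    (hface : ∀ Φ p p', IsCMType c Φ → p' ∉ place c p →
      weilSpace (GSet.faceCornersMul c Φ p p') ≤ Alg (GSet.faceCornersMul c Φ p p'))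
    (M : Multiset (Finset G)) (hM : GSet.IsZeroSumG c M) : weilSpace M ≤ Alg M :=
  (gsetModel Alg Q hmul hproj hQ).alg_of_faces_gset hc hpair hface M hM

end Composition

end HodgeRepro.Night3.GSetModel

/-! ## ERRATUM OF READING (night-3 gen 4, INBOX L6047; appended after the landing of this file)

The instance `gsetModel` above instantiates gen 2's `WeilModel`, whose field `hmul` is stated as
`(Alg M ⊗ Alg N).comap (κ M N) ≤ Alg (M + N)`.  Here `κ M N = kun |M| |N|` is the `(|M|, |N|)`-COMPONENT PROJECTION
`H^{|M|+|N|}(B_M × B_N) → H^{|M|}(B_M) ⊗ H^{|N|}(B_N)`, which is NOT injective: it kills the other Künneth summands of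
that degree.  For a projection the comap form asks every class in `ker κ` to be algebraic — MORE than «products of
pull-backs of algebraic classes are algebraic», and false for the geometric `Alg`.  So the docstrings of `gsetModel`,
`weilSpace_add_le_alg`, `weilSpace_le_alg_of_add` and `weilSpace_le_alg_of_faces` above OVERSTATE the reading of their
hypothesis `hmul` (the theorems themselves are correct as stated).  The honest form — `hmul` on the cross product
`μ : H M ⊗ H N → H (M + N)`, `(Alg M ⊗ Alg N).map μ ≤ Alg (M + N)`, with `κ ∘ μ = id` — is `Night3WeilModelKP` /
`Night3GSetWeilModelKP`, which SUPERSEDE the instance and the four theorems above.  The data `H`, `castH`, `κ`, `ℓ`,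
`weilSpace` and the theorems `hW`, `hℓ` of this file are unaffected and are what the honest instance uses. -/

namespace HodgeRepro.Night3.GSetModel

/-- The cast and its inverse cancel (used by `Night3GSetWeilModelKP.κ_μ`). -/
theorem castH_castH_symm {G : Type*} {d d' : ℕ} (h : d = d') (x : Hn G d') : castH h (castH h.symm x) = x := by
  subst h
  rfl

end HodgeRepro.Night3.GSetModel
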